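import Summits.Schanuel.Schanuel.Theses.RoyCriterion
import Literature.Barriers.Schanuel.LargeTranscendenceDegree

/-!
# Crux-triage r1-1, idea `hl-collapse-line-purity` — costume test, kernel-checked

`LinePurity'` below is the natural reading of the card's `LinePurity` ("a field of transcendence
degree ≤ 1 carries no two ℚ-independent exponential points", i.e. exponential rank one per line).
We check, self-contained (the disprover's `Cruxes/SchanuelTwo/Disproof.lean` is not yet built on
the farm, so its two helpers are re-proved inline; `RankLeTrdeg'` is a verbatim copy of
route ExpMordellWeil's target):
(1) `SchanuelTwo ↔ LinePurity'` is two one-liners;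
(2) `LinePurity'` is literally the `n = 2`, `trdeg K ≤ 1` instance of route ExpMordellWeil's
    target `RankLeTrdeg` (Mantova–Zannier 2016 Prop. 2.2 / Marker 2006);
(3) the "depth-one pairs" reduction (`schanuelTwo_iff_depthOne_pairs` of the ideator's Sketch)
    is likewise immediate (no Hermite–Lindemann needed).
-/

set_option linter.dupNamespace false

noncomputable section

open Complex IntermediateField
open Summit.Schanuel.Schanuel.Theses.RoyCriterion (SchanuelTwo)

namespace TriageA

/-- The Schanuel field of a pair. -/
abbrev SF (x : Fin 2 → ℂ) : IntermediateField ℚ ℂ :=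
  adjoin ℚ (Set.range x ∪ Set.range (Complex.exp ∘ x))

theorem SF_le {x : Fin 2 → ℂ} {L : IntermediateField ℚ ℂ} (h0 : x 0 ∈ L) (h1 : x 1 ∈ L)
    (e0 : cexp (x 0) ∈ L) (e1 : cexp (x 1) ∈ L) : SF x ≤ L := by
  rw [adjoin_le_iff]
  rintro z (⟨i, rfl⟩ | ⟨i, rfl⟩)
  · fin_cases i
    · exact h0
    · exact h1
  · fin_cases i
    · exact e0
    · exact e1

theorem two_le_trdeg_of_algebraicIndependent {L : IntermediateField ℚ ℂ} {v : Fin 2 → ℂ}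
    (hv : AlgebraicIndependent ℚ v) (hmem : ∀ i, v i ∈ L) :
    (2 : Cardinal) ≤ Algebra.trdeg ℚ L := by
  let y : Fin 2 → L := fun i => ⟨v i, hmem i⟩
  have hy : AlgebraicIndependent ℚ y := AlgebraicIndependent.of_comp L.val hv
  simpa using hy.cardinalMk_le_trdeg

/-- In `Cardinal`, `¬ 2 ≤ t` gives `t ≤ 1`. -/
theorem le_one_of_not_two_le {t : Cardinal} (h : ¬ (2 : Cardinal) ≤ t) : t ≤ 1 := by
  have ht2 : t < 2 := not_le.mp h
  have h2al : (2 : Cardinal) < Cardinal.aleph0 := by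
    exact_mod_cast Cardinal.natCast_lt_aleph0 (n := 2)
  obtain ⟨n, rfl⟩ := Cardinal.lt_aleph0.1 (ht2.trans h2al)
  have h2' : n < 2 := by exact_mod_cast ht2
  have : n ≤ 1 := by omega
  exact_mod_cast this

/-- Rank-2 / trdeg-≤-1 slice of `ExpMordellWeil.RankLeTrdeg`. -/
def LinePurity' : Prop :=
  ∀ (K : IntermediateField ℚ ℂ), Algebra.trdeg ℚ K ≤ 1 →
    ∀ u : Fin 2 → ℂ, (∀ i, u i ∈ K ∧ cexp (u i) ∈ K) → ¬ LinearIndependent ℚ u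

/-- "Depth-one pairs" form of the crux: both coordinates are depth-one seeds. -/
def SchanuelTwoDepthOnePairs : Prop :=
  ∀ x : Fin 2 → ℂ, LinearIndependent ℚ x →
    (∀ i, ¬ AlgebraicIndependent ℚ ![x i, cexp (x i)]) → (2 : Cardinal) ≤ Algebra.trdeg ℚ (SF x)

theorem schanuelTwo_imp_linePurity' (hS : SchanuelTwo) : LinePurity' := by
  intro K hK u hu hlin
  have h2 : (2 : Cardinal) ≤ Algebra.trdeg ℚ (SF u) := hS u hlin
  have hle : SF u ≤ K := SF_le (hu 0).1 (hu 1).1 (hu 0).2 (hu 1).2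
  have h21 : (2 : Cardinal) ≤ 1 :=
    (h2.trans (Literature.Barriers.Schanuel.trdeg_mono hle)).trans hK
  exact Nat.not_ofNat_le_one h21

theorem linePurity'_imp_schanuelTwo (hP : LinePurity') : SchanuelTwo := by
  intro x hx
  by_contra hlt
  exact hP (SF x) (le_one_of_not_two_le hlt) x (fun i => ⟨subset_adjoin ℚ _ (Or.inl ⟨i, rfl⟩),
    subset_adjoin ℚ _ (Or.inr ⟨i, rfl⟩)⟩) hx

/-- (1) The card's reformulation is an `Iff` by two one-liners. -/
theorem schanuelTwo_iff_linePurity' : SchanuelTwo ↔ LinePurity' :=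
  ⟨schanuelTwo_imp_linePurity', linePurity'_imp_schanuelTwo⟩

/-- Verbatim copy of route ExpMordellWeil's target `Summit.Schanuel.Schanuel.Theses.ExpMordellWeil.RankLeTrdeg`
(item stmt-Schanuel-3486), inlined so that this workfile does not import a gate-regenerated route file. -/
def RankLeTrdeg' : Prop :=
  ∀ (K : IntermediateField ℚ ℂ) (n : ℕ) (u : Fin n → ℂ), (∀ i, u i ∈ K ∧ Complex.exp (u i) ∈ K) →
    LinearIndependent ℚ u → (n : Cardinal) ≤ Algebra.trdeg ℚ K

/-- (2) `LinePurity'` is the `n = 2`, `trdeg K ≤ 1` instance of ExpMordellWeil's target. -/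
theorem linePurity'_of_rankLeTrdeg (h : RankLeTrdeg') : LinePurity' := by
  intro K hK u hu hlin
  have h' := (h K 2 u hu hlin).trans hK
  have h21 : (2 : Cardinal.{0}) ≤ 1 := by exact_mod_cast h'
  exact Nat.not_ofNat_le_one h21

/-- (3) Restricting to depth-one pairs loses nothing (an algebraically independent
`(x i, e^{x i})` inside `SF x` already gives `trdeg ≥ 2`). -/
theorem schanuelTwo_iff_depthOnePairs : SchanuelTwo ↔ SchanuelTwoDepthOnePairs := by
  constructor
  · exact fun hS x hx _ => hS x hx
  · intro h x hx
    by_contra hlt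
    refine hlt (h x hx (fun i hind => hlt ?_))
    refine two_le_trdeg_of_algebraicIndependent hind (fun j => ?_)
    fin_cases j
    · exact subset_adjoin ℚ _ (Or.inl ⟨i, rfl⟩)
    · exact subset_adjoin ℚ _ (Or.inr ⟨i, rfl⟩)

end TriageA

end
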